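import Summits.RiemannHypothesis.RiemannHypothesis.Theorems.PfPersistenceF1Beurling

/-!
# PF persistence, fake seat 1 — the residual typed statement BL-EXT(U) (GAP F1-G-b″, RULING A137)

Unit `pub-rhpf-fake-1` of the `pub-rhpf` cell (mechanism / rigidity campaign; **no RH claims**); the kernel
target named by RULING A137 (ADJ-LOG) for `HOME/FAKES.md §1.8.4` / `GAP-CLASSES.md` row F1-G.

A **spectral measure** of an explicit-formula datum `F` is an even, locally finite, polynomially bounded
positive measure `μ` on the critical line representing its Weil quadratic form,
`Q_F(g) = ∫ ‖ĝ(1/2 + it)‖² dμ(t)` on Weil tests (`ĝ = weilMellin g`).  `BLExt U` is the set of spectral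
measures of `ζ`-dressed discrete g-prime systems (`beurlingDatum g m`) that are HONEST BELOW DEPTH `U`
(their prime-type term agrees with `ζ`'s on every compactly supported test living in `(−log U, log U)`).
Granting RH and simplicity, `ζ`'s own spectral measure is the zero-counting measure `μ_Z`; a member of
`BLExt U` represented by a system that is NOT prime-identical would be a Weil-positive fake of depth `U`.

Proved here (structural, sorry-free): a datum with a spectral measure is Weil-positive
(`positivity_of_isSpectralMeasure`); hence `BeurlingRigidity` implies that every member of every
`BLExt U` is represented only by prime-identical systems (`blExtRigid_of_beurlingRigidity`); `BLExt` is
antitone in the depth; honesty at depth `1` is automatic, so that, granting the (open,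
Bochner–Schwartz-type) existence of spectral measures for Weil-positive g-systems
(`SpectralMeasureExists`, a hypothesis, not asserted), `BeurlingRigidity ↔ ∀ U, BLExtRigid U`
(`beurlingRigidity_iff_blExtRigid`).  The depth parameter matters for CONSTRUCTIONS (inhabit `BLExt U`
non-trivially for large `U`), not for the equivalence — recorded, not hidden.
-/

set_option linter.dupNamespace false

noncomputable section

open MeasureTheory Set Complex

namespace Summit.RiemannHypothesis.RiemannHypothesis.Theorems.PfPersistence.Fake1.BLExt

open Literature.NumberTheory.LFunctions
open Summit.RiemannHypothesis.RiemannHypothesis.Theorems.PfPersistenceBarrier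
open Summit.RiemannHypothesis.RiemannHypothesis.Theorems.PfPersistenceBarrier.ExplicitDatum
open Summit.RiemannHypothesis.RiemannHypothesis.Theorems.PfPersistence.Fake1

/-- `μ` is a SPECTRAL MEASURE (on the critical line) of the datum `F`: even, finite on compacts with
polynomial growth, and `Q_F(g) = ∫ ‖ĝ(1/2 + it)‖² dμ(t)` for every Weil test `g` (integrand integrable).
(A problem-side notion of the campaign, FAKES §1.8.4 / A137; not a Literature fact.) -/
def IsSpectralMeasure (F : ExplicitDatum) (μ : Measure ℝ) : Prop :=
  μ.map (fun t : ℝ => -t) = μ ∧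
  (∃ C N : ℝ, ∀ T : ℝ, 0 ≤ T → μ (Icc (-T) T) ≠ ⊤ ∧ (μ (Icc (-T) T)).toReal ≤ C * (1 + T) ^ N) ∧
  ∀ g : ℝ → ℂ, IsWeilTest g →
    Integrable (fun t : ℝ => ‖weilMellin g (1 / 2 + t * I)‖ ^ 2) μ ∧
    F.quadratic g = ((∫ t : ℝ, ‖weilMellin g (1 / 2 + t * I)‖ ^ 2 ∂μ : ℝ) : ℂ)

/-- `F` is HONEST BELOW DEPTH `U`: its prime-type term agrees with `ζ`'s on every compactly supported
test whose topological support lies in `(−log U, log U)` (for a g-prime system: the generalised prime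
powers below `U`, with multiplicity and weight, are exactly the prime powers below `U`). [folklore] -/
def HonestBelow (F : ExplicitDatum) (U : ℝ) : Prop :=
  ∀ k : ℝ → ℂ, HasCompactSupport k → tsupport k ⊆ Ioo (-Real.log U) (Real.log U) →
    F.primeTerm k = zetaC.primeTerm k

/-- `(g, m)` is PRIME-IDENTICAL as a datum: its prime-type term equals `ζ`'s on all compactly supported
tests (the negation of the hypothesis of `BeurlingRigidity`). [folklore] -/
def PrimeIdentical (g : ℕ → ℝ) (m : ℕ → ℕ) : Prop :=
  ∀ k : ℝ → ℂ, HasCompactSupport k → (beurlingDatum g m).primeTerm k = zetaC.primeTerm k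

/-- **BL-EXT(U)** (GAP F1-G-b″ as re-typed 2026-08-19, RULING A137): the set of spectral measures of
`ζ`-dressed discrete g-prime systems (`g` injective with values `> 1`, multiplicities `m`) honest below
depth `U`.  (A problem-side typed residual statement's carrier; not a gap class, not a Literature fact.) -/
def BLExt (U : ℝ) : Set (Measure ℝ) :=
  {μ | ∃ (g : ℕ → ℝ) (m : ℕ → ℕ), (∀ i, 1 < g i) ∧ Function.Injective g ∧
      HonestBelow (beurlingDatum g m) U ∧ IsSpectralMeasure (beurlingDatum g m) μ}

/-- **BL-EXT RIGIDITY at depth `U`** (the closable form of 'BL-EXT(U) ∖ {μ_Z} = ∅' that does not need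
`μ_Z`): every spectral measure of an honest-below-`U` g-prime system is represented only by
prime-identical systems.  OPEN for `U > 1` beyond what `BeurlingRigidity` gives. (A `Prop`: statement
only; not a Literature fact.) -/
def BLExtRigid (U : ℝ) : Prop :=
  ∀ (μ : Measure ℝ) (g : ℕ → ℝ) (m : ℕ → ℕ), (∀ i, 1 < g i) → Function.Injective g →
    HonestBelow (beurlingDatum g m) U → IsSpectralMeasure (beurlingDatum g m) μ → PrimeIdentical g m

/-- EXISTENCE OF SPECTRAL MEASURES (the Bochner–Schwartz direction of THEOREM F1-E restricted to
g-prime systems; THEOREM-informal, kernel OPEN — used below only as a hypothesis): a Weil-positive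
`ζ`-dressed g-prime system has a spectral measure. (A `Prop`: statement only; not a Literature fact.) -/
def SpectralMeasureExists : Prop :=
  ∀ (g : ℕ → ℝ) (m : ℕ → ℕ), (∀ i, 1 < g i) → Function.Injective g →
    (beurlingDatum g m).Positivity → ∃ μ : Measure ℝ, IsSpectralMeasure (beurlingDatum g m) μ

/-! ## Structural lemmas (PROVED) -/

/-- A datum with a spectral measure is Weil-positive at all windows. [folklore] -/
theorem positivity_of_isSpectralMeasure {F : ExplicitDatum} {μ : Measure ℝ}
    (h : IsSpectralMeasure F μ) : F.Positivity := by
  intro g hg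
  obtain ⟨-, hq⟩ := h.2.2 g hg
  rw [hq, Complex.ofReal_re]
  exact integral_nonneg fun t => by positivity

/-- `BeurlingRigidity` closes BL-EXT at every depth: members are represented only by prime-identical
systems. [folklore] -/
theorem blExtRigid_of_beurlingRigidity (h : BeurlingRigidity) (U : ℝ) : BLExtRigid U := by
  intro μ g m hg hinj _ hμ
  by_contra hne
  exact h g m hg hinj hne (positivity_of_isSpectralMeasure hμ)

/-- The prime-type term of the zero test vanishes. [folklore] -/
theorem primeTerm_zero (F : ExplicitDatum) : F.primeTerm 0 = 0 := by
  simp [ExplicitDatum.primeTerm]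

/-- Honesty is automatic at depth `1` (the window `(−log 1, log 1)` is empty). [folklore] -/
theorem honestBelow_one (F : ExplicitDatum) : HonestBelow F 1 := by
  intro k _ hk
  have hempty : Ioo (-Real.log 1) (Real.log 1) = ∅ := by simp
  have hk0 : k = 0 := by
    funext x
    refine image_eq_zero_of_notMem_tsupport fun hx => ?_
    have := hk hx
    rw [hempty] at this
    exact this
  subst hk0
  rw [primeTerm_zero, primeTerm_zero]

/-- Honesty is inherited by smaller depths. [folklore] -/
theorem HonestBelow.anti {F : ExplicitDatum} {U U' : ℝ} (h : HonestBelow F U') (hU : 0 < U)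
    (hUU' : U ≤ U') : HonestBelow F U := by
  intro k hk hsupp
  refine h k hk (hsupp.trans (Ioo_subset_Ioo ?_ ?_))
  · exact neg_le_neg (Real.log_le_log hU hUU')
  · exact Real.log_le_log hU hUU'

/-- `BLExt` is antitone in the depth (on `U > 0`). [folklore] -/
theorem blExt_antitone {U U' : ℝ} (hU : 0 < U) (hUU' : U ≤ U') : BLExt U' ⊆ BLExt U := by
  rintro μ ⟨g, m, hg, hinj, hhon, hμ⟩
  exact ⟨g, m, hg, hinj, hhon.anti hU hUU', hμ⟩

/-- Rigidity at depth `1` (where honesty is vacuous) already gives `BeurlingRigidity`, granting the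
existence of spectral measures for Weil-positive g-systems. [folklore] -/
theorem beurlingRigidity_of_blExtRigid (hS : SpectralMeasureExists) (h : BLExtRigid 1) :
    BeurlingRigidity := by
  intro g m hg hinj hne hpos
  obtain ⟨μ, hμ⟩ := hS g m hg hinj hpos
  exact hne (h μ g m hg hinj (honestBelow_one _) hμ)

/-- **`BeurlingRigidity ↔ ∀ U, BLExtRigid U`** granting `SpectralMeasureExists` (RULING A137 (A2): the
equivalence is THEOREM-informal with inputs F1-E / F1-B / F1-C; here the Bochner–Schwartz input is the
explicit hypothesis `hS` and the rest is kernel-checked). [folklore] -/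
theorem beurlingRigidity_iff_blExtRigid (hS : SpectralMeasureExists) :
    BeurlingRigidity ↔ ∀ U : ℝ, BLExtRigid U :=
  ⟨fun h U => blExtRigid_of_beurlingRigidity h U, fun h => beurlingRigidity_of_blExtRigid hS (h 1)⟩

/-- Set form: under `BeurlingRigidity`, a member of `BLExt U` is the spectral measure of a prime-identical
system (so, granting RH and simple zeros informally, it is `μ_Z`). [folklore] -/
theorem primeIdentical_of_mem_blExt (h : BeurlingRigidity) {U : ℝ} {μ : Measure ℝ} (hμ : μ ∈ BLExt U) :
    ∃ (g : ℕ → ℝ) (m : ℕ → ℕ), PrimeIdentical g m ∧ IsSpectralMeasure (beurlingDatum g m) μ := by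
  obtain ⟨g, m, hg, hinj, hhon, hsp⟩ := hμ
  exact ⟨g, m, blExtRigid_of_beurlingRigidity h U μ g m hg hinj hhon hsp, hsp⟩

end Summit.RiemannHypothesis.RiemannHypothesis.Theorems.PfPersistence.Fake1.BLExt
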